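import Summits.Parity.GeneralizedHardyLittlewood.Theorems.TableChowla.Negative.TableChowlaCornerDomination

/-!
# `TableChowla` (stmt-Parity-14270), line `corner-local-box`: stub `stub_doubleVdC`

The exact finite DOUBLE van der Corput localisation of the fourth moment
`T = Σ_{a,a' ∈ (A₁,A₂]} S(a,a')²`, `S(a,a') = Σ_{b ≤ B} f(ab+c) f(a'b+c)`, of a 1-bounded table:
for all widths `H, K ≥ 1`,

  `H·K·T ≤ (N+H−1)(B+K−1)·[N·B·K + 2·N·B·H + 4·Σ_{1≤h≤H−1} Σ_{1≤k≤K−1} |𝒞(h,k)|]`, `N = A₂ − A₁`,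

where `𝒞(h,k) = Σ_{a ∈ (A₁,A₂−h]} Σ_{b ∈ [1,B−k]} f(ab+c) f((a+h)b+c) f(a(b+k)+c) f((a+h)(b+k)+c)` is
the off-axis in-box corner sum. The proof is that of `Negative.corner_domination` (van der Corput
across the rows, then across the columns inside each weighted row pair, symmetric collapse of both
pair sums, regrouping of the off-axes part by the gaps) with two sharpenings: the overlap sum
`Σ_{a'} w(a,a') ≤ H²` (`sum_overlapW_le_sq`, double counting) in place of `2H²`, and the SUM of the
`|𝒞(h,k)|` kept in place of their supremum (`corner_domination_sum`). `stub_doubleVdC` is the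
registered signature, obtained by identifying the restricted corner sums `cornerRes` with the
inlined ones (`cornerRes_eq_inline`) and `Ico 1 H = Icc 1 (H−1)`. Pure finite combinatorics.
[folklore]
-/

namespace Summit.Parity.GeneralizedHardyLittlewood.Theorems.TableChowla.CornerLocalBox

open Finset Real
open Summit.Parity.GeneralizedHardyLittlewood.Theorems.TableChowla.Negative

noncomputable section

variable {M : Finset ℕ} {H : ℕ}

/-- SHARP overlap sum (double counting): `Σ_{a' ∈ S} w(a,a') ≤ H²` whenever the window of `a`
lies in `M` — each of the `H` points of the window `[a,a+H)` lies in at most `H` windows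
`[a',a'+H)`. -/
theorem sum_overlapW_le_sq (S : Finset ℕ) (a : ℕ) (haM : ∀ m, a ≤ m → m < a + H → m ∈ M) :
    ∑ a' ∈ S, overlapW M H a a' ≤ (H : ℝ) ^ 2 := by
  have key : ∑ a' ∈ S, (M.filter (fun m => (a ≤ m ∧ m < a + H) ∧ (a' ≤ m ∧ m < a' + H))).card ≤
      H * H := by
    calc ∑ a' ∈ S, (M.filter (fun m => (a ≤ m ∧ m < a + H) ∧ (a' ≤ m ∧ m < a' + H))).card
        = ∑ a' ∈ S, ∑ m ∈ M.filter (fun m => a ≤ m ∧ m < a + H),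
            if a' ≤ m ∧ m < a' + H then 1 else 0 := by
          refine sum_congr rfl fun a' _ => ?_
          rw [← filter_filter, card_filter]
      _ = ∑ m ∈ M.filter (fun m => a ≤ m ∧ m < a + H),
            (S.filter (fun a' => a' ≤ m ∧ m < a' + H)).card := by
          rw [sum_comm]
          exact sum_congr rfl fun m _ => (card_filter _ _).symm
      _ ≤ ∑ _m ∈ M.filter (fun m => a ≤ m ∧ m < a + H), H := by
          refine sum_le_sum fun m _ => ?_
          calc (S.filter (fun a' => a' ≤ m ∧ m < a' + H)).card
              ≤ (Finset.Ico (m + 1 - H) (m + 1)).card := by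
                apply card_le_card
                intro a' ha'
                simp only [mem_filter] at ha'
                rw [Finset.mem_Ico]; omega
            _ ≤ H := by rw [Nat.card_Ico]; omega
      _ = H * H := by rw [sum_const, smul_eq_mul, card_window_eq haM]
  unfold overlapW; rw [sq]; exact_mod_cast key

/-- The rows whose `h`-translate is still a row: `{a ∈ (A₁,A₂] : a + h ∈ (A₁,A₂]} = (A₁, A₂ − h]`. -/
theorem filter_Ioc_shift (A₁ A₂ h : ℕ) :
    (Ioc A₁ A₂).filter (fun a => a + h ∈ Ioc A₁ A₂) = Ioc A₁ (A₂ - h) := by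
  ext a; simp only [mem_filter, mem_Ioc]; omega

/-- The columns whose `k`-translate is still a column: `{b ∈ [1,B] : b + k ∈ [1,B]} = [1, B − k]`. -/
theorem filter_Icc_shift (B k : ℕ) :
    (Icc 1 B).filter (fun b => b + k ∈ Icc 1 B) = Icc 1 (B - k) := by
  ext b; simp only [mem_filter, mem_Icc]; omega

/-- `[1, H) = [1, H − 1]` in `ℕ`. -/
theorem Ico_one_eq_Icc (H : ℕ) : Finset.Ico 1 H = Finset.Icc 1 (H - 1) := by
  ext m; simp only [Finset.mem_Ico, Finset.mem_Icc]; omega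

/-- The restricted corner sum `cornerRes` written out over the plain ranges `(A₁, A₂−h] × [1, B−k]`
with the four table entries inlined. -/
theorem cornerRes_eq_inline (f : ℕ → ℝ) (c : ℤ) (A₁ A₂ B h k : ℕ) :
    cornerRes f c A₁ A₂ B h k = ∑ a ∈ Ioc A₁ (A₂ - h), ∑ b ∈ Icc 1 (B - k),
      f (Int.toNat ((a : ℤ) * b + c)) * f (Int.toNat (((a : ℤ) + h) * b + c)) *
        f (Int.toNat ((a : ℤ) * ((b : ℤ) + k) + c)) *
          f (Int.toNat (((a : ℤ) + h) * ((b : ℤ) + k) + c)) := by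
  unfold cornerRes
  rw [filter_Ioc_shift, filter_Icc_shift]
  refine sum_congr rfl fun a _ => sum_congr rfl fun b _ => ?_
  unfold boxProd
  push_cast
  ring

variable {f : ℕ → ℝ} {c : ℤ} {A₁ A₂ B : ℕ}

/-- **CORNER (LOCAL BOX) DOMINATION, summed form.** For `|f| ≤ 1` and windows `H, K ≥ 1`:
`H·K·T ≤ (A₂+H−1−A₁)(B+K−1)·(N·B·K + 2·N·B·H + 4·Σ_{1≤h<H} Σ_{1≤k<K} |cornerRes h k|)`
(`N` = number of rows): `Negative.corner_domination` with the sharp overlap sums and the sum of the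
restricted corner sums in place of their supremum. -/
theorem corner_domination_sum (hf : ∀ n, |f n| ≤ 1) {H K : ℕ} (hH : 1 ≤ H) (hK : 1 ≤ K) :
    (H : ℝ) * K * momentN f c A₁ A₂ B ≤
      ((A₂ + H - 1 - A₁ : ℕ) : ℝ) * ((B + K - 1 : ℕ) : ℝ) *
        (((Ioc A₁ A₂).card : ℝ) * B * K + 2 * ((Ioc A₁ A₂).card : ℝ) * B * H +
          4 * ∑ h ∈ Finset.Ico 1 H, ∑ k ∈ Finset.Ico 1 K, |cornerRes f c A₁ A₂ B h k|) := by
  set I : Finset ℕ := Ioc A₁ A₂ with hI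
  set J : Finset ℕ := Icc 1 B with hJ
  set M : Finset ℕ := Icc (A₁ + 1) (A₂ + H - 1) with hM
  set M' : Finset ℕ := Icc 1 (B + K - 1) with hM'
  have hIM : ∀ a ∈ I, ∀ m, a ≤ m → m < a + H → m ∈ M := by
    intro a ha m h1 h2; rw [hI, mem_Ioc] at ha; rw [hM, mem_Icc]; omega
  have hJM : ∀ b ∈ J, ∀ m, b ≤ m → m < b + K → m ∈ M' := by
    intro b hb m h1 h2; rw [hJ, mem_Icc] at hb; rw [hM', mem_Icc]; omega
  have hMcard : (M.card : ℝ) = ((A₂ + H - 1 - A₁ : ℕ) : ℝ) := by rw [hM, Nat.card_Icc]; congr 1; omega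
  have hM'card : (M'.card : ℝ) = ((B + K - 1 : ℕ) : ℝ) := by rw [hM', Nat.card_Icc, Nat.add_sub_cancel]
  have hJcard : (J.card : ℝ) = B := by rw [hJ, Nat.card_Icc, Nat.add_sub_cancel]
  set e : ℕ → ℕ → ℝ := fun a b => f (Int.toNat ((a : ℤ) * b + c)) with he
  -- inner (column) weighted sums
  set inner : ℕ → ℕ → ℝ := fun a a' => ∑ b ∈ J, ∑ b' ∈ J, overlapW M' K b b' * boxProd f c a a' b b'
    with hinner
  -- Step 1 (rows): H² T ≤ |M| Σ w S²
  have step1 : (H : ℝ) ^ 2 * momentN f c A₁ A₂ B ≤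
      (M.card : ℝ) * ∑ a ∈ I, ∑ a' ∈ I, overlapW M H a a' * rowCorr f c B a a' ^ 2 := by
    have hpt : ∀ b b' : ℕ, (H : ℝ) ^ 2 * (∑ a ∈ I, e a b * e a b') ^ 2 ≤
        (M.card : ℝ) * ∑ a ∈ I, ∑ a' ∈ I, (e a b * e a b') * (e a' b * e a' b') * overlapW M H a a' :=
      fun b b' => vdC_pointwise (fun a => e a b * e a b') hIM
    have hT : momentN f c A₁ A₂ B = ∑ b ∈ Icc 1 B, ∑ b' ∈ Icc 1 B, (∑ a ∈ I, e a b * e a b') ^ 2 := by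
      rw [momentN_eq_colMoment]
    rw [hT, mul_sum]
    simp_rw [mul_sum (s := Icc 1 B) (a := (H : ℝ) ^ 2)]
    calc ∑ b ∈ Icc 1 B, ∑ b' ∈ Icc 1 B, (H : ℝ) ^ 2 * (∑ a ∈ I, e a b * e a b') ^ 2
        ≤ ∑ b ∈ Icc 1 B, ∑ b' ∈ Icc 1 B,
            (M.card : ℝ) * ∑ a ∈ I, ∑ a' ∈ I, (e a b * e a b') * (e a' b * e a' b') * overlapW M H a a' :=
          sum_le_sum fun b _ => sum_le_sum fun b' _ => hpt b b'
      _ = (M.card : ℝ) * ∑ a ∈ I, ∑ a' ∈ I, overlapW M H a a' * rowCorr f c B a a' ^ 2 := by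
          rw [mul_sum]
          simp_rw [mul_sum (a := (M.card : ℝ))]
          simp_rw [sum_comm (s := Icc 1 B) (t := I)]
          refine sum_congr rfl fun a _ => sum_congr rfl fun a' _ => ?_
          simp_rw [← mul_sum]
          congr 1
          unfold rowCorr
          rw [sq, sum_mul_sum, mul_sum]
          refine sum_congr rfl fun b _ => ?_
          rw [mul_sum]
          refine sum_congr rfl fun b' _ => ?_
          simp only [he]
          ring
  -- Step 2 (columns): K² S(a,a')² ≤ |M'| inner(a,a')
  have step2 : ∀ a a' : ℕ, (K : ℝ) ^ 2 * rowCorr f c B a a' ^ 2 ≤ (M'.card : ℝ) * inner a a' := by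
    intro a a'
    have hv := vdC_pointwise (I := J) (M := M') (H := K) (fun b => e a b * e a' b) hJM
    have hS : rowCorr f c B a a' = ∑ b ∈ J, e a b * e a' b := by unfold rowCorr; rfl
    rw [hS]
    refine le_trans hv (le_of_eq (congrArg _ (sum_congr rfl fun b _ => sum_congr rfl fun b' _ => ?_)))
    simp only [overlapW, boxProd, he]
    ring
  -- Combine: H²K² T ≤ |M||M'| Q
  set Q : ℝ := ∑ a ∈ I, ∑ a' ∈ I, overlapW M H a a' * inner a a' with hQ
  have e1 : (K : ℝ) ^ 2 * ((M.card : ℝ) * ∑ a ∈ I, ∑ a' ∈ I, overlapW M H a a' * rowCorr f c B a a' ^ 2) =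
      (M.card : ℝ) * ∑ a ∈ I, ∑ a' ∈ I, overlapW M H a a' * ((K : ℝ) ^ 2 * rowCorr f c B a a' ^ 2) := by
    rw [mul_left_comm, Finset.mul_sum]
    refine congrArg _ (sum_congr rfl fun a _ => ?_)
    rw [Finset.mul_sum]
    exact sum_congr rfl fun a' _ => by ring
  have e2 : (M.card : ℝ) * ∑ a ∈ I, ∑ a' ∈ I, overlapW M H a a' * ((M'.card : ℝ) * inner a a') =
      (M.card : ℝ) * (M'.card : ℝ) * Q := by
    have hin : ∑ a ∈ I, ∑ a' ∈ I, overlapW M H a a' * ((M'.card : ℝ) * inner a a') =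
        (M'.card : ℝ) * ∑ a ∈ I, ∑ a' ∈ I, overlapW M H a a' * inner a a' := by
      rw [Finset.mul_sum]
      refine sum_congr rfl fun a _ => ?_
      rw [Finset.mul_sum]
      exact sum_congr rfl fun a' _ => by ring
    rw [hin, hQ]; ring
  have hcomb : ((H : ℝ) ^ 2 * (K : ℝ) ^ 2) * momentN f c A₁ A₂ B ≤ (M.card : ℝ) * (M'.card : ℝ) * Q := by
    calc ((H : ℝ) ^ 2 * (K : ℝ) ^ 2) * momentN f c A₁ A₂ B
        = (K : ℝ) ^ 2 * ((H : ℝ) ^ 2 * momentN f c A₁ A₂ B) := by ring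
      _ ≤ (K : ℝ) ^ 2 * ((M.card : ℝ) * ∑ a ∈ I, ∑ a' ∈ I, overlapW M H a a' * rowCorr f c B a a' ^ 2) :=
          mul_le_mul_of_nonneg_left step1 (by positivity)
      _ = (M.card : ℝ) * ∑ a ∈ I, ∑ a' ∈ I, overlapW M H a a' * ((K : ℝ) ^ 2 * rowCorr f c B a a' ^ 2) := e1
      _ ≤ (M.card : ℝ) * ∑ a ∈ I, ∑ a' ∈ I, overlapW M H a a' * ((M'.card : ℝ) * inner a a') := by
          apply mul_le_mul_of_nonneg_left _ (Nat.cast_nonneg _)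
          exact sum_le_sum fun a _ => sum_le_sum fun a' _ =>
            mul_le_mul_of_nonneg_left (step2 a a') (overlapW_nonneg _ _ _ _)
      _ = (M.card : ℝ) * (M'.card : ℝ) * Q := e2
  -- Symmetric collapse in the rows: Q = D_a + 2 U
  have hGsymm : ∀ a a', overlapW M H a a' * inner a a' = overlapW M H a' a * inner a' a := by
    intro a a'
    rw [overlapW_symm]
    exact congrArg _ (sum_congr rfl fun b _ => sum_congr rfl fun b' _ => by rw [boxProd_symm_rows])
  have hQsplit := sum_pairs_symm I (fun a a' => overlapW M H a a' * inner a a') hGsymm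
  -- Symmetric collapse in the columns: inner a a' = D_b a a' + 2 U_b a a'
  have hinner_symm : ∀ a a' b b', overlapW M' K b b' * boxProd f c a a' b b' =
      overlapW M' K b' b * boxProd f c a a' b' b := by
    intro a a' b b'; rw [overlapW_symm, boxProd_symm_cols]
  have hinner_split : ∀ a a', inner a a' = ∑ b ∈ J, overlapW M' K b b * boxProd f c a a' b b +
      2 * ∑ b ∈ J, ∑ b' ∈ J.filter (fun b' => b < b'), overlapW M' K b b' * boxProd f c a a' b b' := by
    intro a a'
    simp only [hinner]
    exact sum_pairs_symm J (fun b b' => overlapW M' K b b' * boxProd f c a a' b b') (hinner_symm a a')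
  -- (i) the row-diagonal part (sharp column overlap sum `≤ K²`)
  have hDa : |∑ a ∈ I, overlapW M H a a * inner a a| ≤ (I.card : ℝ) * B * H * (K : ℝ) ^ 2 := by
    calc |∑ a ∈ I, overlapW M H a a * inner a a| ≤ ∑ a ∈ I, |overlapW M H a a * inner a a| :=
          abs_sum_le_sum_abs _ _
      _ ≤ ∑ _a ∈ I, (H : ℝ) * (B * (K : ℝ) ^ 2) := by
          refine sum_le_sum fun a ha => ?_
          rw [abs_mul, abs_of_nonneg (overlapW_nonneg _ _ _ _)]
          have hw : overlapW M H a a ≤ H := by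
            unfold overlapW; exact_mod_cast card_overlap_le (hIM a ha)
          have hin : |inner a a| ≤ B * (K : ℝ) ^ 2 := by
            simp only [hinner]
            calc |∑ b ∈ J, ∑ b' ∈ J, overlapW M' K b b' * boxProd f c a a b b'|
                ≤ ∑ b ∈ J, |∑ b' ∈ J, overlapW M' K b b' * boxProd f c a a b b'| := abs_sum_le_sum_abs _ _
              _ ≤ ∑ b ∈ J, ∑ b' ∈ J, overlapW M' K b b' := by
                  refine sum_le_sum fun b _ => le_trans (abs_sum_le_sum_abs _ _) (sum_le_sum fun b' _ => ?_)
                  rw [abs_mul, abs_of_nonneg (overlapW_nonneg _ _ _ _)]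
                  exact mul_le_of_le_one_right (overlapW_nonneg _ _ _ _) (abs_boxProd_le hf _ _ _ _)
              _ ≤ ∑ _b ∈ J, (K : ℝ) ^ 2 := sum_le_sum fun b hb => sum_overlapW_le_sq J b (hJM b hb)
              _ = B * (K : ℝ) ^ 2 := by rw [sum_const, nsmul_eq_mul, hJcard]
          exact mul_le_mul hw hin (abs_nonneg _) (Nat.cast_nonneg _)
      _ = (I.card : ℝ) * B * H * (K : ℝ) ^ 2 := by rw [sum_const, nsmul_eq_mul]; ring
  -- (ii) the column-diagonal inside the strict upper row pairs (sharp row overlap sum `≤ H²`)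
  have hDb : |∑ a ∈ I, ∑ a' ∈ I.filter (fun a' => a < a'),
      overlapW M H a a' * ∑ b ∈ J, overlapW M' K b b * boxProd f c a a' b b| ≤
      (I.card : ℝ) * B * (H : ℝ) ^ 2 * K := by
    calc |∑ a ∈ I, ∑ a' ∈ I.filter (fun a' => a < a'),
          overlapW M H a a' * ∑ b ∈ J, overlapW M' K b b * boxProd f c a a' b b|
        ≤ ∑ a ∈ I, ∑ a' ∈ I.filter (fun a' => a < a'),
            |overlapW M H a a' * ∑ b ∈ J, overlapW M' K b b * boxProd f c a a' b b| :=
          le_trans (abs_sum_le_sum_abs _ _) (sum_le_sum fun a _ => abs_sum_le_sum_abs _ _)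
      _ ≤ ∑ a ∈ I, ∑ a' ∈ I.filter (fun a' => a < a'), overlapW M H a a' * (B * K) := by
          refine sum_le_sum fun a _ => sum_le_sum fun a' _ => ?_
          rw [abs_mul, abs_of_nonneg (overlapW_nonneg _ _ _ _)]
          refine mul_le_mul_of_nonneg_left ?_ (overlapW_nonneg _ _ _ _)
          calc |∑ b ∈ J, overlapW M' K b b * boxProd f c a a' b b|
              ≤ ∑ b ∈ J, |overlapW M' K b b * boxProd f c a a' b b| := abs_sum_le_sum_abs _ _
            _ ≤ ∑ _b ∈ J, (K : ℝ) := sum_le_sum fun b hb => by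
                rw [abs_mul, abs_of_nonneg (overlapW_nonneg _ _ _ _)]
                have hw : overlapW M' K b b ≤ K := by
                  unfold overlapW; exact_mod_cast card_overlap_le (hJM b hb)
                calc overlapW M' K b b * |boxProd f c a a' b b| ≤ overlapW M' K b b * 1 :=
                      mul_le_mul_of_nonneg_left (abs_boxProd_le hf _ _ _ _) (overlapW_nonneg _ _ _ _)
                  _ ≤ K := by rw [mul_one]; exact hw
            _ = B * K := by rw [sum_const, nsmul_eq_mul, hJcard]
      _ ≤ ∑ a ∈ I, ∑ a' ∈ I, overlapW M H a a' * (B * K) := by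
          refine sum_le_sum fun a _ => sum_le_sum_of_subset_of_nonneg (filter_subset _ _) fun _ _ _ => ?_
          exact mul_nonneg (overlapW_nonneg _ _ _ _) (by positivity)
      _ ≤ ∑ _a ∈ I, (H : ℝ) ^ 2 * (B * K) := by
          refine sum_le_sum fun a ha => ?_
          rw [← sum_mul]
          exact mul_le_mul_of_nonneg_right (sum_overlapW_le_sq I a (hIM a ha)) (by positivity)
      _ = (I.card : ℝ) * B * (H : ℝ) ^ 2 * K := by rw [sum_const, nsmul_eq_mul]; ring
  -- (iii) the off-axes part = Σ_{h,k} (H−h)(K−k) 𝒞(h,k)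
  have hV : ∑ a ∈ I, ∑ a' ∈ I.filter (fun a' => a < a'),
      overlapW M H a a' * ∑ b ∈ J, ∑ b' ∈ J.filter (fun b' => b < b'), overlapW M' K b b' * boxProd f c a a' b b' =
      ∑ h ∈ Finset.Ico 1 H, ∑ k ∈ Finset.Ico 1 K,
        ((H - h : ℕ) : ℝ) * ((K - k : ℕ) : ℝ) * cornerRes f c A₁ A₂ B h k := by
    -- rows: vanish beyond the window, regroup by h, exact weight H − h
    rw [sum_upper_window I _ H (fun a _ a' _ hfar => by
      rw [show overlapW M H a a' = 0 by
        unfold overlapW; rw [card_overlap_eq_zero (by omega), Nat.cast_zero], zero_mul])]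
    have hrow : ∀ a ∈ I, ∀ h ∈ (Finset.Ico 1 H).filter (fun h => a + h ∈ I),
        overlapW M H a (a + h) = ((H - h : ℕ) : ℝ) := by
      intro a ha h hh
      rw [mem_filter, Finset.mem_Ico] at hh
      unfold overlapW
      rw [card_overlap_eq (hIM a ha) hh.1.2]
    rw [sum_congr rfl fun a ha => sum_congr rfl fun h hh => by rw [hrow a ha h hh]]
    -- columns: same, inside
    have hcol : ∀ a a' : ℕ, ∑ b ∈ J, ∑ b' ∈ J.filter (fun b' => b < b'), overlapW M' K b b' * boxProd f c a a' b b' =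
        ∑ b ∈ J, ∑ k ∈ (Finset.Ico 1 K).filter (fun k => b + k ∈ J),
          ((K - k : ℕ) : ℝ) * boxProd f c a a' b (b + k) := by
      intro a a'
      rw [sum_upper_window J _ K (fun b _ b' _ hfar => by
        rw [show overlapW M' K b b' = 0 by
          unfold overlapW; rw [card_overlap_eq_zero (by omega), Nat.cast_zero], zero_mul])]
      refine sum_congr rfl fun b hb => sum_congr rfl fun k hk => ?_
      rw [mem_filter, Finset.mem_Ico] at hk
      unfold overlapW
      rw [card_overlap_eq (hJM b hb) hk.1.2]
    simp_rw [hcol]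
    -- now swap: Σ_a Σ_h[filter] Σ_b Σ_k[filter] → Σ_h Σ_k Σ_a[filter] Σ_b[filter]
    rw [sum_filter_comm I (Finset.Ico 1 H)]
    refine sum_congr rfl fun h _ => ?_
    simp_rw [mul_sum]
    rw [sum_comm]
    have : ∀ b ∈ J, ∑ a ∈ I.filter (fun a => a + h ∈ I), ∑ k ∈ (Finset.Ico 1 K).filter (fun k => b + k ∈ J),
        ((H - h : ℕ) : ℝ) * (((K - k : ℕ) : ℝ) * boxProd f c a (a + h) b (b + k)) =
        ∑ k ∈ (Finset.Ico 1 K).filter (fun k => b + k ∈ J), ∑ a ∈ I.filter (fun a => a + h ∈ I),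
        ((H - h : ℕ) : ℝ) * (((K - k : ℕ) : ℝ) * boxProd f c a (a + h) b (b + k)) := fun b _ => sum_comm
    rw [sum_congr rfl this, sum_filter_comm J (Finset.Ico 1 K)]
    refine sum_congr rfl fun k _ => ?_
    unfold cornerRes
    rw [← hI, ← hJ, mul_sum, sum_comm]
    refine sum_congr rfl fun a _ => ?_
    rw [mul_sum]
    exact sum_congr rfl fun b _ => by ring
  -- bound on (iii): keep the sum of the |corner sums|
  have hVbound : |∑ h ∈ Finset.Ico 1 H, ∑ k ∈ Finset.Ico 1 K,
      ((H - h : ℕ) : ℝ) * ((K - k : ℕ) : ℝ) * cornerRes f c A₁ A₂ B h k| ≤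
      (H : ℝ) * K * ∑ h ∈ Finset.Ico 1 H, ∑ k ∈ Finset.Ico 1 K, |cornerRes f c A₁ A₂ B h k| := by
    calc |∑ h ∈ Finset.Ico 1 H, ∑ k ∈ Finset.Ico 1 K,
          ((H - h : ℕ) : ℝ) * ((K - k : ℕ) : ℝ) * cornerRes f c A₁ A₂ B h k|
        ≤ ∑ h ∈ Finset.Ico 1 H, ∑ k ∈ Finset.Ico 1 K,
            |((H - h : ℕ) : ℝ) * ((K - k : ℕ) : ℝ) * cornerRes f c A₁ A₂ B h k| :=
          le_trans (abs_sum_le_sum_abs _ _) (sum_le_sum fun h _ => abs_sum_le_sum_abs _ _)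
      _ ≤ ∑ h ∈ Finset.Ico 1 H, ∑ k ∈ Finset.Ico 1 K, (H : ℝ) * K * |cornerRes f c A₁ A₂ B h k| := by
          refine sum_le_sum fun h _ => sum_le_sum fun k _ => ?_
          rw [abs_mul, abs_mul, abs_of_nonneg (Nat.cast_nonneg _), abs_of_nonneg (Nat.cast_nonneg _)]
          have h1 : ((H - h : ℕ) : ℝ) ≤ H := by exact_mod_cast Nat.sub_le H h
          have h2 : ((K - k : ℕ) : ℝ) ≤ K := by exact_mod_cast Nat.sub_le K k
          exact mul_le_mul_of_nonneg_right (mul_le_mul h1 h2 (Nat.cast_nonneg _) (Nat.cast_nonneg _))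
            (abs_nonneg _)
      _ = (H : ℝ) * K * ∑ h ∈ Finset.Ico 1 H, ∑ k ∈ Finset.Ico 1 K, |cornerRes f c A₁ A₂ B h k| := by
          rw [mul_sum]
          exact sum_congr rfl fun h _ => by rw [mul_sum]
  -- assemble Q
  have hU : ∑ a ∈ I, ∑ a' ∈ I.filter (fun a' => a < a'), overlapW M H a a' * inner a a' =
      ∑ a ∈ I, ∑ a' ∈ I.filter (fun a' => a < a'),
        overlapW M H a a' * ∑ b ∈ J, overlapW M' K b b * boxProd f c a a' b b +
      2 * ∑ a ∈ I, ∑ a' ∈ I.filter (fun a' => a < a'),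
        overlapW M H a a' * ∑ b ∈ J, ∑ b' ∈ J.filter (fun b' => b < b'), overlapW M' K b b' * boxProd f c a a' b b' := by
    rw [mul_sum, ← sum_add_distrib]
    refine sum_congr rfl fun a _ => ?_
    rw [mul_sum, ← sum_add_distrib]
    exact sum_congr rfl fun a' _ => by rw [hinner_split]; ring
  -- pure arithmetic on opaque reals (keeps `ring`/`linarith` away from the big sums)
  have arith : ∀ (q u v x1 x2 x3 b1 b2 b3 : ℝ), q = x1 + 2 * u → u = x2 + 2 * v → v = x3 →
      |x1| ≤ b1 → |x2| ≤ b2 → |x3| ≤ b3 → |q| ≤ b1 + 2 * b2 + 4 * b3 := by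
    intro q u v x1 x2 x3 b1 b2 b3 h1 h2 h3 h4 h5 h6
    subst h1; subst h2; subst h3
    rw [abs_le] at h4 h5 h6 ⊢
    constructor <;> linarith only [h4.1, h4.2, h5.1, h5.2, h6.1, h6.2]
  have hQbound : |Q| ≤ (I.card : ℝ) * B * H * (K : ℝ) ^ 2 + 2 * ((I.card : ℝ) * B * (H : ℝ) ^ 2 * K) +
      4 * ((H : ℝ) * K * ∑ h ∈ Finset.Ico 1 H, ∑ k ∈ Finset.Ico 1 K, |cornerRes f c A₁ A₂ B h k|) :=
    arith _ _ _ _ _ _ _ _ _ (hQ.trans hQsplit) hU hV hDa hDb hVbound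
  -- finish (arithmetic on opaque reals again): cancel one `H·K`
  have finish : ∀ (T m m' q i b hh kk s : ℝ), hh ^ 2 * kk ^ 2 * T ≤ m * m' * q → 0 ≤ m → 0 ≤ m' →
      0 < hh → 0 < kk → |q| ≤ i * b * hh * kk ^ 2 + 2 * (i * b * hh ^ 2 * kk) + 4 * (hh * kk * s) →
      hh * kk * T ≤ m * m' * (i * b * kk + 2 * i * b * hh + 4 * s) := by
    intro T m m' q i b hh kk s h1 hm hm' hh0 hk0 h2
    have e0 : i * b * hh * kk ^ 2 + 2 * (i * b * hh ^ 2 * kk) + 4 * (hh * kk * s) =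
        (hh * kk) * (i * b * kk + 2 * i * b * hh + 4 * s) := by ring
    rw [e0] at h2
    have h3 : q ≤ (hh * kk) * (i * b * kk + 2 * i * b * hh + 4 * s) := le_trans (le_abs_self q) h2
    have h4 := le_trans h1 (mul_le_mul_of_nonneg_left h3 (mul_nonneg hm hm'))
    have h5 : (hh * kk) * (hh * kk * T) ≤ (hh * kk) * (m * m' * (i * b * kk + 2 * i * b * hh + 4 * s)) := by
      have e1 : (hh * kk) * (hh * kk * T) = hh ^ 2 * kk ^ 2 * T := by ring
      have e2 : (hh * kk) * (m * m' * (i * b * kk + 2 * i * b * hh + 4 * s)) =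
          m * m' * ((hh * kk) * (i * b * kk + 2 * i * b * hh + 4 * s)) := by ring
      rw [e1, e2]; exact h4
    exact le_of_mul_le_mul_left h5 (mul_pos hh0 hk0)
  have hHpos : (0 : ℝ) < H := by exact_mod_cast hH
  have hKpos : (0 : ℝ) < K := by exact_mod_cast hK
  have hfin := finish _ _ _ _ _ _ _ _ _ hcomb (Nat.cast_nonneg _) (Nat.cast_nonneg _) hHpos hKpos hQbound
  rw [hMcard, hM'card] at hfin
  exact hfin

/-- **STUB 1 · `stub_doubleVdC`** of line `corner-local-box` (registered signature, verbatim): the exact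
finite double van der Corput localisation
`H·K·T ≤ (N+H−1)(B+K−1)·[N·B·K + 2·N·B·H + 4·Σ_{1≤h≤H−1} Σ_{1≤k≤K−1} |𝒞_f(h,k)|]`, `N = A₂ − A₁`,
for every 1-bounded `f`, every shift `c`, all ranges and all widths `H, K ≥ 1`. -/
theorem stub_doubleVdC : ∀ f : ℕ → ℝ, (∀ n, |f n| ≤ 1) → ∀ (c : ℤ) (A₁ A₂ B H K : ℕ), 1 ≤ H → 1 ≤ K →
    (H : ℝ) * K * (∑ a ∈ Finset.Ioc A₁ A₂, ∑ a' ∈ Finset.Ioc A₁ A₂,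
      (∑ b ∈ Finset.Icc 1 B, f (Int.toNat ((a : ℤ) * b + c)) * f (Int.toNat ((a' : ℤ) * b + c))) ^ 2) ≤
      (((A₂ - A₁ : ℕ) : ℝ) + H - 1) * ((B : ℝ) + K - 1) *
        (((A₂ - A₁ : ℕ) : ℝ) * B * K + 2 * ((A₂ - A₁ : ℕ) : ℝ) * B * H +
          4 * ∑ h ∈ Finset.Icc 1 (H - 1), ∑ k ∈ Finset.Icc 1 (K - 1),
            |∑ a ∈ Finset.Ioc A₁ (A₂ - h), ∑ b ∈ Finset.Icc 1 (B - k),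
              f (Int.toNat ((a : ℤ) * b + c)) * f (Int.toNat (((a : ℤ) + h) * b + c)) *
                f (Int.toNat ((a : ℤ) * ((b : ℤ) + k) + c)) *
                  f (Int.toNat (((a : ℤ) + h) * ((b : ℤ) + k) + c))|) := by
  intro f hf c A₁ A₂ B H K hH hK
  have hmain := corner_domination_sum (f := f) (c := c) (A₁ := A₁) (A₂ := A₂) (B := B) hf hH hK
  have hN : (((Ioc A₁ A₂).card : ℕ) : ℝ) = ((A₂ - A₁ : ℕ) : ℝ) := by rw [Nat.card_Ioc]
  have hMle : ((A₂ + H - 1 - A₁ : ℕ) : ℝ) ≤ ((A₂ - A₁ : ℕ) : ℝ) + H - 1 := by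
    have h1 : A₂ + H - 1 - A₁ ≤ (A₂ - A₁) + (H - 1) := by omega
    have h2 : ((A₂ + H - 1 - A₁ : ℕ) : ℝ) ≤ (((A₂ - A₁) + (H - 1) : ℕ) : ℝ) := by exact_mod_cast h1
    rw [Nat.cast_add, Nat.cast_sub hH, Nat.cast_one] at h2
    linarith
  have hM' : ((B + K - 1 : ℕ) : ℝ) = (B : ℝ) + K - 1 := by
    rw [Nat.cast_sub (by omega), Nat.cast_add, Nat.cast_one]
  have hK1 : (1 : ℝ) ≤ K := by exact_mod_cast hK
  have hcorner : ∑ h ∈ Finset.Ico 1 H, ∑ k ∈ Finset.Ico 1 K, |cornerRes f c A₁ A₂ B h k| =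
      ∑ h ∈ Finset.Icc 1 (H - 1), ∑ k ∈ Finset.Icc 1 (K - 1),
        |∑ a ∈ Finset.Ioc A₁ (A₂ - h), ∑ b ∈ Finset.Icc 1 (B - k),
          f (Int.toNat ((a : ℤ) * b + c)) * f (Int.toNat (((a : ℤ) + h) * b + c)) *
            f (Int.toNat ((a : ℤ) * ((b : ℤ) + k) + c)) *
              f (Int.toNat (((a : ℤ) + h) * ((b : ℤ) + k) + c))| := by
    rw [Ico_one_eq_Icc H, Ico_one_eq_Icc K]
    exact sum_congr rfl fun h _ => sum_congr rfl fun k _ => by rw [cornerRes_eq_inline]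
  rw [hN, hcorner, hM'] at hmain
  unfold momentN rowCorr at hmain
  refine le_trans hmain (mul_le_mul_of_nonneg_right (mul_le_mul_of_nonneg_right hMle (by linarith)) ?_)
  positivity

end

end Summit.Parity.GeneralizedHardyLittlewood.Theorems.TableChowla.CornerLocalBox
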